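import Summits.QuantumFields.YangMills.Theorems.BalabanLadderROTSingleAngle
import Summits.QuantumFields.YangMills.Theorems.BalabanLadderUVSeamRecUnitTransfer
import HarnessLib

/-!
# Crux `ROT` (stmt-QuantumFields-20042): the infrared guard — the King mechanism consumes `GapInUnits` at the same `(r, a)`; the IR-guarded forms of the rotation leg and their composition to the summit

Helper file (`--supports stmt-QuantumFields-20042`) of the fleet lead `ym-spine-20042-p1` (generation g2), line of record «King
split», skeleton v4 «king-limit» (`Cruxes/ROT/Lines/birth.lean`, 824d5540ff52cfd5; ONE registered stub `stub_kingLimit : KingLimit`,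
vocabulary `Theorems/BalabanLadderROTDefs.lean` §1–§3; `stub_uvExtract : UVExtract` PROVED, `Theorems/BalabanLadderROTUVExtract.lean`).

LOCATED FINDING (g2, evidence `FINDING-20042-IR-guard.md` on the item).  The only printed mechanism for the rotation leg — C. King,
Commun. Math. Phys. **103** (1986) 323–349, Thm 2.4 via Prop. 4.1 / Thm 4.2 — is a FIXED-VOLUME statement: the two orientations are
compared on ONE torus `D_J` fitted by both lattices (side a multiple of `25`, p. 326–327, (4.1)), and the comparison estimates (4.6),
(4.7), (4.9) carry the factor `|D_J|` (the volume); the passage to the physical, infinite-volume theory is printed as CONDITIONAL on the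
periodic-boundary-condition infinite-volume limit (2.24) «we can expect that a cluster expansion would give …» (p. 327) — a clustering
input.  The crux `ROT` (and the registered `KingLimit`, and `KingSingle`) quantify over EVERY admissible scheme, and along every
admissible scheme the physical torus side DIVERGES (§1: `a_k (2 L_k + 1) ≥ 2 / a_k → ∞`, from the range clause `a_k⁻² ≤ L_k`); so a
King-type proof needs a volume-uniform locality input at the physical scale, which neither guard of `ROT` carries (`MomentBounds6`:
centred-moment decay inside ONE torus up to physical distance `ℓ₄`; `LowerBounds`: none), while the route's deciding theorem
`Theses.BalabanLadder.closes` HOLDS the infrared leg `GapInUnits G r a` at the same `(r, a)` when it invokes `ROT` (BalabanLadder.lean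
:647, :650).  This file kernel-checks the repair the finding recommends (owner's / planner's call, D-0014):

* §1 `two_mul_inv_le_physicalSide`, `tendsto_physicalSide_atTop` — along every admissible scheme the physical torus side tends to `∞`.
* §2 the IR-GUARDED forms, spelled out (no definition): `rotIR_of_kingLimitIR` (the v4 stub text with `GapInUnits G r a →` inserted
  implies `ROT` with the same guard inserted — verbatim `rot_of_kingLimit` with the guard threaded), `rotIR_of_kingSingleIR` (the
  one-angle lattice form), `kingLimitIR_iff_kingSingleIR` (the two guarded texts are equivalent, as the unguarded ones are),
  `rotIR_of_rot` / `kingLimitIR_of_kingLimit` (the guarded forms are WEAKER than the registered ones — monotonicity, nothing lost).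
* §3 `closes_of_rotIR` — **the IR-guarded rotation leg closes the route**: `UV → UVSeamRec → NT → IR → ROT_IR → UVOtherGroups →
  YangMills`, the proof of `Theses.BalabanLadder.closes` re-run passing `hIR` to the rotation leg (both branches).  So re-typing `ROT`
  with the extra guard (rev 2) costs the assembly nothing and hands the E1 prover exactly the input King's mechanism consumes.

No definition, no named fact, no sorry; standard axioms.  NOT a proof of E1 and NOT progress on the open mathematics of `stub_kingLimit`
(the two-orientation comparison of Bałaban's YM₄ flows through the crossover, unprinted): a plan-level repair, kernel-checked.
-/

set_option autoImplicit false

noncomputable section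

open scoped SchwartzMap
open MeasureTheory Filter Topology Real
open Literature.MathematicalPhysics.QuantumFieldTheory Literature.MathematicalPhysics.QuantumLattice
open Literature.MathematicalPhysics.AQFT Literature.Probability.LatticeModels
open Summit.QuantumFields.YangMills.Cruxes.OSLegsFromFemtoAndGap.DlrCollarTransfer
open Summit.QuantumFields.YangMills.Cruxes.OSLegsAtWeakCouplingC.Sketch
open Summit.QuantumFields.YangMills.Cruxes.OSLegsAtWeakCouplingC.Y2Bridge
open Summit.QuantumFields.YangMills.Theorems.OSLegsFromFemtoAndGap (latticeDist)
open Summit.QuantumFields.YangMills.Theorems.NPointIsotropy.Negative (E4)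

namespace Summit.QuantumFields.YangMills.Theorems.ROT

/-! ## §1 Along every admissible scheme the physical volume diverges -/

section Volume

variable {G : Type} [Group G] [MeasurableSpace G]

/-- **The physical torus side dominates `2 / a_k`**: for an admissible scheme (`IsLegScheme`: range clause `a_k⁻¹ · a_k⁻¹ ≤ L_k`)
the side of the torus `(ℤ/(2L_k+1))⁴` in physical units satisfies `2 · a_k⁻¹ ≤ a_k · (2 L_k + 1)`. [folklore] -/
theorem two_mul_inv_le_physicalSide (a : ℝ → ℝ) (sch : SpeciesScheme (YMSpecies G)) (h : IsLegScheme a sch) (k : ℕ) :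
    2 * (sch.a k)⁻¹ ≤ sch.a k * (2 * (sch.L k : ℝ) + 1) := by
  obtain ⟨-, -, hr⟩ := h
  obtain ⟨-, -, -, hL⟩ := hr k
  have ha : 0 < sch.a k := sch.a_pos k
  have h1 : (sch.a k)⁻¹ ≤ sch.a k * sch.L k := by
    have hmul := mul_le_mul_of_nonneg_left hL ha.le
    calc (sch.a k)⁻¹ = sch.a k * ((sch.a k)⁻¹ * (sch.a k)⁻¹) := by field_simp
      _ ≤ sch.a k * sch.L k := hmul
  nlinarith [ha]

/-- **Along every admissible scheme the physical torus side tends to `∞`**: `a_k (2 L_k + 1) ≥ 2 / a_k → ∞` since `a_k → 0⁺`.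
Hence any two-orientation (King) comparison serving `LatticeRotWard` / `KingLimit` / `KingSingle` runs on tori of DIVERGING physical
volume — where King's printed estimates (CMP 103 (1986) Thm 4.2 (4.6)–(4.9), factor `|D_J|`) are not uniform. [folklore] -/
theorem tendsto_physicalSide_atTop (a : ℝ → ℝ) (sch : SpeciesScheme (YMSpecies G)) (h : IsLegScheme a sch) :
    Tendsto (fun k => sch.a k * (2 * (sch.L k : ℝ) + 1)) atTop atTop := by
  have h0 : Tendsto sch.a atTop (𝓝[>] 0) :=
    tendsto_nhdsWithin_iff.2 ⟨sch.tendsto_a, Eventually.of_forall fun k => sch.a_pos k⟩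
  have hinv : Tendsto (fun k => 2 * (sch.a k)⁻¹) atTop atTop :=
    (tendsto_inv_nhdsGT_zero.comp h0).const_mul_atTop two_pos
  exact tendsto_atTop_mono (two_mul_inv_le_physicalSide a sch h) hinv

end Volume

/-! ## §2 The IR-guarded forms of the rotation leg (spelled out; no definition) -/

/-- **`KingLimit` with the infrared guard ⇒ `ROT` with the infrared guard** — verbatim `rot_of_kingLimit` with `GapInUnits G r a`
threaded: compactness by the PROVED `stub_uvExtract`, King-invariance of the limit points ⇒ lattice KING at the Pythagorean angles
(`latticeKingWard_of_uvCompactAt_of_limitsKingInvariant`) ⇒ `LatticeRotWard` (King upgrade at a dense subgroup).  The `LowerBounds`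
guard is not used. [C. King, CMP 103 (1986) Thm 2.4 — mechanism] -/
theorem rotIR_of_kingLimitIR
    (hKL : ∀ (G : Type) [Group G] [TopologicalSpace G] [IsTopologicalGroup G] [CompactSpace G],
      IsCompactSimpleLieGroup G → letI : MeasurableSpace G := borel G; haveI : BorelSpace G := ⟨rfl⟩;
      ∀ (r : LatticeRep G) (a : ℝ → ℝ), (∀ β, 0 < a β) → Tendsto a atTop (𝓝 0) → MomentBounds6 G r a →
        GapInUnits G r a →
        ∀ sch : SpeciesScheme (YMSpecies G), IsLegScheme a sch → ∃ r₀ : ℝ, 0 < r₀ ∧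
          ∀ φ : ℕ → ℕ, Tendsto φ atTop atTop → ∀ S₁ : SchwingerFamily E4, OffDiagLimitAlong r sch φ S₁ →
            ∀ (n : ℕ), 2 ≤ n → ∀ F ∈ King.KingClass n r₀, ∀ θ ∈ (King.pythagoreanAngles : Set ℝ),
              S₁ n (linActMulti (planeRot (0 : Fin 3) θ) F) = S₁ n F) :
    ∀ (G : Type) [Group G] [TopologicalSpace G] [IsTopologicalGroup G] [CompactSpace G],
      IsCompactSimpleLieGroup G → letI : MeasurableSpace G := borel G; haveI : BorelSpace G := ⟨rfl⟩;
      ∀ (r : LatticeRep G) (a : ℝ → ℝ), (∀ β, 0 < a β) → Tendsto a atTop (𝓝 0) →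
        LowerBounds G r a → MomentBounds6 G r a → GapInUnits G r a → LatticeRotWard G r a := by
  intro G _ _ _ _ hG
  letI : MeasurableSpace G := borel G
  haveI : BorelSpace G := ⟨rfl⟩
  intro r a ha ha0 _ hUV hIR
  have hX : UVCompactAt r a := stub_uvExtract G hG r a ha ha0 hUV
  exact latticeRotWard_of_uvCompactAt_of_latticeKingWard r a hX _ King.dense_closure_pythagoreanAngles
    (latticeKingWard_of_uvCompactAt_of_limitsKingInvariant r a hX _ (hKL G hG r a ha ha0 hUV hIR))

/-- **`KingSingle` with the infrared guard ⇒ `ROT` with the infrared guard** — the one-angle lattice form (King's `(3,4,5)` pair,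
`θ₀ = arcsin (3/5)`, `θ₀ / 2π ∉ ℚ`): `latticeRotWard_of_uvCompactAt_of_latticeKingWard_single` with `GapInUnits G r a` threaded.
[C. King, CMP 103 (1986) Thm 2.4 — mechanism] -/
theorem rotIR_of_kingSingleIR
    (hKS : ∀ (G : Type) [Group G] [TopologicalSpace G] [IsTopologicalGroup G] [CompactSpace G],
      IsCompactSimpleLieGroup G → letI : MeasurableSpace G := borel G; haveI : BorelSpace G := ⟨rfl⟩;
      ∀ (r : LatticeRep G) (a : ℝ → ℝ), (∀ β, 0 < a β) → Tendsto a atTop (𝓝 0) → MomentBounds6 G r a →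
        GapInUnits G r a → LatticeKingWard G r a ({Real.arcsin (3 / 5)} : Set ℝ)) :
    ∀ (G : Type) [Group G] [TopologicalSpace G] [IsTopologicalGroup G] [CompactSpace G],
      IsCompactSimpleLieGroup G → letI : MeasurableSpace G := borel G; haveI : BorelSpace G := ⟨rfl⟩;
      ∀ (r : LatticeRep G) (a : ℝ → ℝ), (∀ β, 0 < a β) → Tendsto a atTop (𝓝 0) →
        LowerBounds G r a → MomentBounds6 G r a → GapInUnits G r a → LatticeRotWard G r a := by
  intro G _ _ _ _ hG
  letI : MeasurableSpace G := borel G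
  haveI : BorelSpace G := ⟨rfl⟩
  intro r a ha ha0 _ hUV hIR
  exact latticeRotWard_of_uvCompactAt_of_latticeKingWard_single r a (stub_uvExtract G hG r a ha ha0 hUV)
    irrational_arcsin_three_fifths_div_two_pi (hKS G hG r a ha ha0 hUV hIR)

/-- **The two IR-guarded King texts are equivalent** (as the unguarded ones are, `kingLimit_iff_kingSingle`): limit-point
King-invariance at the Pythagorean angles ⇔ lattice KING at the one angle `arcsin (3/5)`, both in `MomentBounds6` units and under
`GapInUnits` — compactness by `stub_uvExtract`, `⇐` through `LatticeRotWard` and `limitsInvariant_of_latticeRotWard`. [folklore] -/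
theorem kingLimitIR_iff_kingSingleIR :
    (∀ (G : Type) [Group G] [TopologicalSpace G] [IsTopologicalGroup G] [CompactSpace G],
      IsCompactSimpleLieGroup G → letI : MeasurableSpace G := borel G; haveI : BorelSpace G := ⟨rfl⟩;
      ∀ (r : LatticeRep G) (a : ℝ → ℝ), (∀ β, 0 < a β) → Tendsto a atTop (𝓝 0) → MomentBounds6 G r a →
        GapInUnits G r a →
        ∀ sch : SpeciesScheme (YMSpecies G), IsLegScheme a sch → ∃ r₀ : ℝ, 0 < r₀ ∧
          ∀ φ : ℕ → ℕ, Tendsto φ atTop atTop → ∀ S₁ : SchwingerFamily E4, OffDiagLimitAlong r sch φ S₁ →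
            ∀ (n : ℕ), 2 ≤ n → ∀ F ∈ King.KingClass n r₀, ∀ θ ∈ (King.pythagoreanAngles : Set ℝ),
              S₁ n (linActMulti (planeRot (0 : Fin 3) θ) F) = S₁ n F) ↔
    (∀ (G : Type) [Group G] [TopologicalSpace G] [IsTopologicalGroup G] [CompactSpace G],
      IsCompactSimpleLieGroup G → letI : MeasurableSpace G := borel G; haveI : BorelSpace G := ⟨rfl⟩;
      ∀ (r : LatticeRep G) (a : ℝ → ℝ), (∀ β, 0 < a β) → Tendsto a atTop (𝓝 0) → MomentBounds6 G r a →
        GapInUnits G r a → LatticeKingWard G r a ({Real.arcsin (3 / 5)} : Set ℝ)) := by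
  constructor
  · intro h G _ _ _ _ hG
    letI : MeasurableSpace G := borel G
    haveI : BorelSpace G := ⟨rfl⟩
    intro r a ha ha0 hMB hIR
    refine latticeKingWard_of_uvCompactAt_of_limitsKingInvariant r a (stub_uvExtract G hG r a ha ha0 hMB) _
      fun sch hsch => ?_
    obtain ⟨r₀, hr₀, H⟩ := h G hG r a ha ha0 hMB hIR sch hsch
    exact ⟨r₀, hr₀, fun φ hφ S₁ hS₁ n hn F hF θ hθ =>
      H φ hφ S₁ hS₁ n hn F hF θ (by rw [Set.mem_singleton_iff.1 hθ]; exact King.arcsin_three_fifths_mem)⟩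
  · intro h G _ _ _ _ hG
    letI : MeasurableSpace G := borel G
    haveI : BorelSpace G := ⟨rfl⟩
    intro r a ha ha0 hMB hIR sch hsch
    have hR : LatticeRotWard G r a :=
      latticeRotWard_of_uvCompactAt_of_latticeKingWard_single r a (stub_uvExtract G hG r a ha ha0 hMB)
        irrational_arcsin_three_fifths_div_two_pi (h G hG r a ha ha0 hMB hIR)
    obtain ⟨r₀, hr₀, H⟩ := limitsInvariant_of_latticeRotWard r a hR sch hsch
    exact ⟨r₀, hr₀, fun φ hφ S₁ hS₁ n hn F hF θ _ => H φ hφ S₁ hS₁ n hn F hF θ⟩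

/-- **The registered crux implies its IR-guarded form** (an extra hypothesis weakens the statement; nothing is lost by the
re-typing). [folklore] -/
theorem rotIR_of_rot (h : Summit.QuantumFields.YangMills.Theses.BalabanLadder.ROT) :
    ∀ (G : Type) [Group G] [TopologicalSpace G] [IsTopologicalGroup G] [CompactSpace G],
      IsCompactSimpleLieGroup G → letI : MeasurableSpace G := borel G; haveI : BorelSpace G := ⟨rfl⟩;
      ∀ (r : LatticeRep G) (a : ℝ → ℝ), (∀ β, 0 < a β) → Tendsto a atTop (𝓝 0) →
        LowerBounds G r a → MomentBounds6 G r a → GapInUnits G r a → LatticeRotWard G r a := by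
  intro G _ _ _ _ hG
  letI : MeasurableSpace G := borel G
  haveI : BorelSpace G := ⟨rfl⟩
  intro r a ha ha0 hNT hUV _
  exact h G hG r a ha ha0 hNT hUV

/-- **The registered stub implies its IR-guarded form** (`KingLimit` ⇒ `KingLimit` with `GapInUnits G r a` inserted). [folklore] -/
theorem kingLimitIR_of_kingLimit (h : KingLimit) :
    ∀ (G : Type) [Group G] [TopologicalSpace G] [IsTopologicalGroup G] [CompactSpace G],
      IsCompactSimpleLieGroup G → letI : MeasurableSpace G := borel G; haveI : BorelSpace G := ⟨rfl⟩;
      ∀ (r : LatticeRep G) (a : ℝ → ℝ), (∀ β, 0 < a β) → Tendsto a atTop (𝓝 0) → MomentBounds6 G r a →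
        GapInUnits G r a →
        ∀ sch : SpeciesScheme (YMSpecies G), IsLegScheme a sch → ∃ r₀ : ℝ, 0 < r₀ ∧
          ∀ φ : ℕ → ℕ, Tendsto φ atTop atTop → ∀ S₁ : SchwingerFamily E4, OffDiagLimitAlong r sch φ S₁ →
            ∀ (n : ℕ), 2 ≤ n → ∀ F ∈ King.KingClass n r₀, ∀ θ ∈ (King.pythagoreanAngles : Set ℝ),
              S₁ n (linActMulti (planeRot (0 : Fin 3) θ) F) = S₁ n F := by
  intro G _ _ _ _ hG
  letI : MeasurableSpace G := borel G
  haveI : BorelSpace G := ⟨rfl⟩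
  intro r a ha ha0 hMB _
  exact h G hG r a ha ha0 hMB

/-! ## §3 The IR-guarded rotation leg closes the route -/

/-- **`UV → UVSeamRec → NT → IR → ROT_IR → UVOtherGroups → YangMills`** — the route's deciding theorem
`Theses.BalabanLadder.closes` re-run with the rotation leg in its IR-GUARDED form: in both branches (the SU(2) class at the unit of
record `u(β) = exp (sizeLog β 1)`, the other compact simple groups at the unit of `NT`) the infrared leg `IR` is evaluated at the same
`(r, a)` BEFORE the rotation leg and handed to it.  Hence a rev-2 `ROT` carrying `GapInUnits G r a` as a third guard closes the route
with the other five items unchanged. [folklore; glue] -/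
theorem closes_of_rotIR
    (hUV : Summit.QuantumFields.YangMills.Theses.BalabanLadder.UV)
    (hSeam : Summit.QuantumFields.YangMills.Theses.BalabanLadder.UVSeamRec)
    (hNT : Summit.QuantumFields.YangMills.Theses.BalabanLadder.NT)
    (hIR : Summit.QuantumFields.YangMills.Theses.BalabanLadder.IR)
    (hROT : ∀ (G : Type) [Group G] [TopologicalSpace G] [IsTopologicalGroup G] [CompactSpace G],
      IsCompactSimpleLieGroup G → letI : MeasurableSpace G := borel G; haveI : BorelSpace G := ⟨rfl⟩;
      ∀ (r : LatticeRep G) (a : ℝ → ℝ), (∀ β, 0 < a β) → Tendsto a atTop (𝓝 0) →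
        LowerBounds G r a → MomentBounds6 G r a → GapInUnits G r a → LatticeRotWard G r a)
    (hOther : Summit.QuantumFields.YangMills.Theses.BalabanLadder.UVOtherGroups) :
    YangMills := by
  have hu : ∀ β : ℝ, 0 < Real.exp (Summit.QuantumFields.YangMills.Theorems.FemtoTransferGap.sizeLog β 1) :=
    fun β => Real.exp_pos _
  have hu0 : Tendsto (fun β : ℝ => Real.exp (Summit.QuantumFields.YangMills.Theorems.FemtoTransferGap.sizeLog β 1))
      atTop (𝓝 0) :=
    Real.tendsto_exp_atBot.comp Summit.QuantumFields.YangMills.Cruxes.UVSeamRec.UnitTransfer.tendsto_sizeLog_one_atBot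
  refine yangMills_of_legs ?_
  intro G _ _ _ _ hG
  by_cases hcl : Nonempty (G ≃ₜ* Matrix.specialUnitaryGroup (Fin 2) ℂ)
  · obtain ⟨r, hlb, hmb⟩ := hSeam hUV G hG hcl
    have hir := hIR G hG r _ hu hu0 hlb
    exact ⟨r, _, hu, hu0, hmb, hlb, hir, hROT G hG r _ hu hu0 hlb hmb hir⟩
  · obtain ⟨r, a, ha, ha0, hlb⟩ := hNT G hG
    have hmb := hOther G hG (not_nonempty_iff.mp hcl) r a ha ha0 hlb
    have hir := hIR G hG r a ha ha0 hlb
    exact ⟨r, a, ha, ha0, hmb, hlb, hir, hROT G hG r a ha ha0 hlb hmb hir⟩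

end Summit.QuantumFields.YangMills.Theorems.ROT

end
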